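import Literature.NumberTheory.Automorphic.Liu2021.LemD1Item4AtV2SeparationOfBlockZeroTrace
import Literature.NumberTheory.Automorphic.Liu2021.LemD1Item4AtV2NonsplitEpsOfSeparation
import Literature.NumberTheory.Automorphic.Liu2021.LemD1RankTwoCMSameLabelLetter
import HarnessLib

/-!
# LD2 organ «RANK-ONE LINE-TYPES COMPLEMENTARITY» — the ONE organ behind the letter R₂ ([Liu2021, Lem. D.1 (4)] «only if», same label) at the
# anisotropic non-split places: `def LineThetaTypesComplementary₁ : Prop` (untagged organ definition of the line; no theorem, no `sorry`)

Cell `hodgecm-mathlib`, half A line LD2 (socket `stub_S1b_facts` of `Cruxes/HLiu418/Lines/F0_AlbCm`, books row #74R; leaf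
`Cruxes/HLiu418/Lines/F0_P6LD_StubS1bFactsOrganRoad.lean`, ED. 6 to come), seat LD2-p02 (g2), dealer LD2-plan (g2) DEALS #3e (2026-09-02); shared with line
LD1 (leaf `F0_P6LD_StubS1FactsThetaRoad`, ED. 5 to come).  DEFINITION ONLY (one closed `Prop`, the organ's statement; its `stub_organ_lineTypes : … := by sorry`
lives in the leaves, its glue `lemD1_4SameLabelNonsplitCM₂_of_lineThetaTypesComplementary₁` in `Theorems/F0LD2LetterR2OfLineComplementary.lean`).

THE STATEMENT.  For a CM field `L` (`L⁺` its maximal real subfield, `c̄` complex conjugation, `δ = imagUnit L`), a real non-zero rank-ONE frame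
`dV₁ : Fin 1 → L`, a conjugate-symplectic idèle class character `λ` of `L`, two lines `a, a′ ∈ (L⁺)ˣ` and a finite place `v` of `L⁺` NON-SPLIT in `L` at which
the Step-1 representatives `ε(a·δ)`, `ε(a′·δ)` are NOT in the same local norm class (the guard, in the tokens of the `hsep` hypothesis of ★
`sameClass_and_chi_eq_of_areIsomorphicRep_localType₂_nonsplit_of_separation`): for EVERY open-kernel character `ξ` of the compact torus
`U(diag dV₁)(L⁺_v) = L_v¹`,
    `dim ω_{s_{a′}}[ξ] + dim ω_{s_a}[ξ] = 1`,
where `s_x` is the line-model rank-one CM θ-package section of the line `x` over the frame `dV₁` at `v` — A-p19 (g30)'s token contract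
`RANK1-SECTION-shape.LD2-Pprime-organ.A-p19g30.txt` (sha16 9d3d7cb590d27713) VERBATIM: `lineTransportSection (Fp L) L c̄ 1 … (realDiagonal L dV₁ hdV₁) …
(Matrix.diagonal dV₁) … x v ((congrW L (Equiv.prodUnique (Fin 1) (Fin 1)) dV₁ hdV₁ … (undoubledSplittings L … (toHeckeCharacter L λ) …) …).s v) (….proj_s v)`,
i.e. the same `λ`-normalised Kudla splitting on the two hermitian lines — and `ω_{s_x} = (MpPsi.toRep (localSchrodinger (Fp L) 1 (realDiagonal L dV₁ hdV₁) v)).comp s_x`.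
In words: each character of `L_v¹` occurs in EXACTLY ONE of the two same-`λ` rank-one Weil representations attached to the two classes of hermitian lines, with
multiplicity one.  This is the `hdich` hypothesis shape of ★ `blockComplement_of_finrank_weightSpace_add_eq_one`
(`MoeglinVignerasWaldspurger1987/RankOneThetaLiftLinesDisjointOfBlockComplement.lean` :168–172) at rank one, `a′` first.

WHY TRUE (printed; NOT proved here — this is the organ the LD lines book for R₂).  The theta dichotomy ∕ conservation relation for the dual pair
`(U(1), U(1))` over a `p`-adic field: for a fixed splitting character and additive character, a character of `E¹` is a local theta lift from exactly one of the
two isomorphism classes of one-dimensional (skew-)hermitian spaces — Gan–Ichino, «Formal degrees and local theta correspondence», Invent. Math. 195 (2014)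
(arXiv:1409.6824 p. 10, Thm. 4.1, case n = 1, first bullet «exactly one of θ_{ψ,V₁⁺,W₁}(π), θ_{ψ,V₁⁻,W₁}(π) is nonzero»); Harris–Kudla–Sweet, J. AMS 9 (1996),
Cor. 4.4 (p. 962) and Thm. 6.1 (ε-dichotomy for U(1)); Sun–Zhu, J. AMS 28 (2015), Thm. 1.10 (conservation relation); Rogawski, «The multiplicity formula for
A-packets» (1992) and Moen, Pacific J. Math. 158 (1993) (the explicit U(1) Weil representation); Mœglin–Vignéras–Waldspurger, LNM 1291 (1987), Chap. 3 §IV.4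
(Howe duality for unitary pairs); Liu, Camb. J. Math. 9 (2021), App. D Lem. D.1 (4) (p. 126) and §D.1 Steps 1–3 (the CM θ-packages).  Both sections carry the
SAME `λ` (★ `undoubledSplittings … (toHeckeCharacter L λ)` on both lines), which is what makes the dichotomy character trivial (complementary, not merely
complementary-up-to-a-twist, type sets: compare ★ `rankOne_theta_dichotomy`, where two arbitrary sections give complementarity up to a character `θ`).

IN-HOUSE DOOR (road of record, LD bus 2026-09-02 DEALS #2–#3e; not taken tonight): the finite-level TRACE RELATION «`tr ω_{s_a}(u)|𝒮^L = − tr ω_{s_{a′}}(u)|𝒮^L`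
near every `u ∉ {1, −1}`» implies this statement by ★ `rankOne_finrank_weightSpace_add_eq_one_of_trace_eq_neg` (thm A, p850122); the trace relation itself is the
quotient of the two big-cell (Kudla) scalars of the sections (★ `rankOne_torusTrace_eq_explicit`, ★ `crossLine_character_identity`; B-p04 (g44) census (P′)₁,
A-p19 (g30) arrows A1–A5), and ★ `eq_of_rankOne_character_relation` (p850132) pins the dichotomy character from it.  CONSUMERS: LD2-p01 (g2)'s CM wrapper
«this statement at `v` ⟹ `hsep` at `v`» (★ `hsep_of_blockZero_complement_of_eq`, p850328, through A-p19's block-restriction identity ★ p850266∕p850343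
`restrictLeft (rank-2 section) = rank-1 section`), then ★ `F0LD1SameLabelRigidityOfSeparation` ∕ LD1-p01's closer ⟹ R₂.

HONEST LABEL: HC_CM is proved only modulo the 7 printed citations (2 remaining: hLiu418 = stmt-HodgeConjecture-24832, h413 = stmt-HodgeConjecture-24833) until
rung 0 closes; this file asserts NOTHING (a definition); when the leaves' `stub_organ_lineTypes` replaces `stub_letter_R₂`, the books read «R₂ paid in-house
modulo the rank-one (U(1),U(1)) dichotomy organ» — count-neutral until that organ is itself paid.
-/

set_option autoImplicit false
set_option linter.dupNamespace false

noncomputable section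

open scoped Matrix Kronecker
open NumberField IsDedekindDomain
open Literature.NumberTheory Literature.NumberTheory.Automorphic Literature.NumberTheory.Automorphic.UnitaryGroup
open Literature.RepresentationTheory Literature.RepresentationTheory.HeisenbergGroup Literature.RepresentationTheory.TwistedCoinv
open Literature.NumberTheory.GelbartRogawski1991 Literature.NumberTheory.GelbartRogawski1991.UnitaryDualPair
open Literature.NumberTheory.GelbartRogawski1991.UnitaryDualPair.WeilCoinv
open Literature.NumberTheory.GelbartRogawski1991.UnitaryDualPair.LocalSplitting
open Literature.NumberTheory.GelbartRogawski1991.GRConstruction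
open Literature.NumberTheory.Weil1964
open Literature.NumberTheory.GaloisRepresentations Literature.RepresentationTheory.HarrisKudlaSweet1996
open Literature.NumberTheory.Automorphic.IdeleClassGroup Literature.RepresentationTheory.Liu2021
open Literature.NumberTheory.Automorphic.Liu2021 Literature.NumberTheory.Automorphic.Liu2021.Def411WeilCarriers
open Literature.NumberTheory.Automorphic.Liu2021.Def411WeilCarriersDoubling
open Literature.NumberTheory.Automorphic.Liu2021.LemD1RankTwoCMLetters
open Literature.RepresentationTheory.MoeglinVignerasWaldspurger1987

namespace Summit.HodgeConjecture.HodgeConjecture.Cruxes.HLiu418.F0LD2LineThetaTypesComplementaryDefs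

set_option synthInstance.maxHeartbeats 400000 in
set_option maxHeartbeats 4000000 in -- the CM θ-package section terms (as ★ `F0LD1SameLabelRigidityOfSeparation`, 4 M)
/-- **LD2∕LD1 organ «RANK-ONE LINE-TYPES COMPLEMENTARITY»** (`(U(1), U(1))` theta dichotomy for the two same-`λ` CM θ-package sections on the two classes of
hermitian lines, at a non-split place where the lines' Step-1 representatives are in different norm classes): for every open-kernel character `ξ` of
`U(diag dV₁)(L⁺_v)`, `dim ω_{s_{a′}}[ξ] + dim ω_{s_a}[ξ] = 1` — the `hdich` shape of ★ `blockComplement_of_finrank_weightSpace_add_eq_one` at the rank-one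
line-model sections of A-p19 (g30)'s token contract (module docstring: statement, printed sources — Gan–Ichino 2014 Thm. 4.1 (n = 1), Harris–Kudla–Sweet 1996
Cor. 4.4 ∕ Thm. 6.1, Sun–Zhu 2015 Thm. 1.10, Rogawski 1992, Moen 1993, MVW 1987 Chap. 3 §IV.4, Liu 2021 Lem. D.1 (4) — and the in-house door via the trace relation
and ★ thm A).  An organ DEFINITION of the line: asserted nowhere in this file. -/
def LineThetaTypesComplementary₁ : Prop :=
  ∀ (L : Type) [Field L] [NumberField L] [IsCMField L]
    (dV₁ : Fin 1 → L) (hdV₁ : ∀ i, IsCMField.complexConj L (dV₁ i) = dV₁ i) (hdV0₁ : ∀ i, dV₁ i ≠ 0)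
    (lam : Literature.NumberTheory.Automorphic.IdeleClassGroup L →ₜ* Circle) (hlam : IsConjugateSymplectic L lam)
    (a a' : (↥(maximalRealSubfield L))ˣ) (v : HeightOneSpectrum (𝓞 ↥(maximalRealSubfield L))),
    (∀ w : UnitaryGroup.PlacesOver L v, IsCMField.complexConj L • (w : HeightOneSpectrum (𝓞 L)) = w) →
    (¬ ∃ x : (LocalRing L v)ˣ, LemD1OfPlace.eps L v (lineDelta_ne_zero (imagUnit_ne_zero L) a) =
        x * Units.map (conjLocal L (IsCMField.complexConj L) v : LocalRing L v →* LocalRing L v) x *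
          LemD1OfPlace.eps L v (lineDelta_ne_zero (imagUnit_ne_zero L) a')) →
    ∀ ξ : (localPi L (IsCMField.complexConj L) 1 (Matrix.diagonal dV₁) v) →* ℂˣ,
      IsOpen (ξ.ker : Set (localPi L (IsCMField.complexConj L) 1 (Matrix.diagonal dV₁) v)) →
      Module.finrank ℂ (weightSpace ((MpPsi.toRep (localSchrodinger (Fp L) 1 (realDiagonal L dV₁ hdV₁) v)).comp
          (lineTransportSection (Fp L) L (IsCMField.complexConj L) 1 (complexConj_imagUnit L) (imagUnit_ne_zero L) (imagUnit_mul_self L) (realDiagonal L dV₁ hdV₁) (realDiagonal_isSymm L dV₁ hdV₁) (Matrix.diagonal dV₁) (realDiagonal_map L dV₁ hdV₁).symm a' v ((congrW L (Equiv.prodUnique (Fin 1) (Fin 1)) dV₁ hdV₁ (lineW L (TW (Fp L) a')) (complexConj_lineW L (TW (Fp L) a')) (realDiagonal_lineW L (TW (Fp L) a')) (diagonal_lineW L (TW (Fp L) a') (JW_eq (Fp L) L a')) (undoubledSplittings L (Equiv.prodUnique (Fin 1) (Fin 1)) dV₁ hdV₁ hdV0₁ (lineW L (TW (Fp L) a'))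 (complexConj_lineW L (TW (Fp L) a')) (lineW_ne_zero L (TW (Fp L) a') (isUnit_det_TW (Fp L) a')) (toHeckeCharacter L lam) (borelPlaceMeasure L) (cmFinLocalFamily L (Equiv.prodUnique (Fin 1) (Fin 1)) dV₁ hdV₁ hdV0₁ (lineW L (TW (Fp L) a')) (complexConj_lineW L (TW (Fp L) a')) (lineW_ne_zero L (TW (Fp L) a') (isUnit_det_TW (Fp L) a')) (toHeckeCharacter L lam) ((isOscillatorChar_toHeckeCharacter_iff lam).mpr hlam) (borelPlaceMeasure L))) (isSymm_TW (Fp L) a') (JW_eq (Fp L) L a')).s v) ((congrW L (Equiv.prodUnique (Fin 1) (Fin 1)) dV₁ hdV₁ (lineW L (TW (Fp L) a')) (complexConj_lineW L (TW (Fp L) a')) (realDiagonal_lineW L (TW (Fp L) a')) (diagonal_lineW L (TW (Fp L) a') (JW_eq (Fp L) L a')) (undoubledSplittings L (Equiv.prodUnique (Fin 1) (Fin 1)) dV₁ hdV₁ hdV0₁ (lineW L (TW (Fp L) a')) (complexConj_lineW L (TW (Fp L) a')) (lineW_ne_zero L (TW (Fp L) a') (isUnit_det_TW (Fp L) a'))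 (toHeckeCharacter L lam) (borelPlaceMeasure L) (cmFinLocalFamily L (Equiv.prodUnique (Fin 1) (Fin 1)) dV₁ hdV₁ hdV0₁ (lineW L (TW (Fp L) a')) (complexConj_lineW L (TW (Fp L) a')) (lineW_ne_zero L (TW (Fp L) a') (isUnit_det_TW (Fp L) a')) (toHeckeCharacter L lam) ((isOscillatorChar_toHeckeCharacter_iff lam).mpr hlam) (borelPlaceMeasure L))) (isSymm_TW (Fp L) a') (JW_eq (Fp L) L a')).proj_s v))) id (fun k => ((ξ k : ℂˣ) : ℂ))) +
        Module.finrank ℂ (weightSpace ((MpPsi.toRep (localSchrodinger (Fp L) 1 (realDiagonal L dV₁ hdV₁) v)).comp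
          (lineTransportSection (Fp L) L (IsCMField.complexConj L) 1 (complexConj_imagUnit L) (imagUnit_ne_zero L) (imagUnit_mul_self L) (realDiagonal L dV₁ hdV₁) (realDiagonal_isSymm L dV₁ hdV₁) (Matrix.diagonal dV₁) (realDiagonal_map L dV₁ hdV₁).symm a v ((congrW L (Equiv.prodUnique (Fin 1) (Fin 1)) dV₁ hdV₁ (lineW L (TW (Fp L) a)) (complexConj_lineW L (TW (Fp L) a)) (realDiagonal_lineW L (TW (Fp L) a)) (diagonal_lineW L (TW (Fp L) a) (JW_eq (Fp L) L a)) (undoubledSplittings L (Equiv.prodUnique (Fin 1) (Fin 1)) dV₁ hdV₁ hdV0₁ (lineW L (TW (Fp L) a)) (complexConj_lineW L (TW (Fp L) a)) (lineW_ne_zero L (TW (Fp L) a) (isUnit_det_TW (Fp L) a)) (toHeckeCharacter L lam) (borelPlaceMeasure L) (cmFinLocalFamily L (Equiv.prodUnique (Fin 1) (Fin 1)) dV₁ hdV₁ hdV0₁ (lineW L (TW (Fp L) a)) (complexConj_lineW L (TW (Fp L) a)) (lineW_ne_zero L (TW (Fp L) a) (isUnit_det_TW (Fp L) a)) (toHeckeCharacter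 L lam) ((isOscillatorChar_toHeckeCharacter_iff lam).mpr hlam) (borelPlaceMeasure L))) (isSymm_TW (Fp L) a) (JW_eq (Fp L) L a)).s v) ((congrW L (Equiv.prodUnique (Fin 1) (Fin 1)) dV₁ hdV₁ (lineW L (TW (Fp L) a)) (complexConj_lineW L (TW (Fp L) a)) (realDiagonal_lineW L (TW (Fp L) a)) (diagonal_lineW L (TW (Fp L) a) (JW_eq (Fp L) L a)) (undoubledSplittings L (Equiv.prodUnique (Fin 1) (Fin 1)) dV₁ hdV₁ hdV0₁ (lineW L (TW (Fp L) a)) (complexConj_lineW L (TW (Fp L) a)) (lineW_ne_zero L (TW (Fp L) a) (isUnit_det_TW (Fp L) a)) (toHeckeCharacter L lam) (borelPlaceMeasure L) (cmFinLocalFamily L (Equiv.prodUnique (Fin 1) (Fin 1)) dV₁ hdV₁ hdV0₁ (lineW L (TW (Fp L) a)) (complexConj_lineW L (TW (Fp L) a)) (lineW_ne_zero L (TW (Fp L) a) (isUnit_det_TW (Fp L) a)) (toHeckeCharacter L lam) ((isOscillatorChar_toHeckeCharacter_iff lam).mpr hlam) (borelPlaceMeasure L))) (isSymm_TW (Fp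 L) a) (JW_eq (Fp L) L a)).proj_s v))) id (fun k => ((ξ k : ℂˣ) : ℂ))) = 1

end Summit.HodgeConjecture.HodgeConjecture.Cruxes.HLiu418.F0LD2LineThetaTypesComplementaryDefs

end
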